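import Literature.AnabelianGeometry.SemiGraphs.GraphOfAnabelioids

/-!
# The pull-back functor `B(ℋ) ⥤ B(𝒢)` of a morphism of semi-graphs of anabelioids ([SemiAnbd] §2)

Mochizuki, *Semi-graphs of anabelioids*, Publ. RIMS **42** (2006) 221–322, §2, author's manuscript
p. 32, Remark 2.11.1 [cite: MochizukiSemiAnbd2006, Rem. 2.11.1 p.32]: "just as in the non-generalized
case, it is immediate from the definitions that every generalized morphism of semi-graphs of connected
anabelioids `Φ : 𝒢 → ℋ` determines, in a natural fashion, a morphism `B(𝒢) → B(ℋ)` between the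
associated anabelioids" — i.e. a pull-back functor `B(ℋ) ⥤ B(𝒢)`; it is also the functor behind
"`B' ×_B 𝒢_v`" of p. 23 (pull-backs of finite étale coverings along a morphism).

This file CONSTRUCTS that functor for a (non-generalized) morphism `φ : 𝒢 → ℋ`
(`SemiGraphOfAnabelioids.Hom`, [SemiAnbd] Remark 2.4.2), over the descent-datum model `BObj` of
`B(−)` of `GraphOfAnabelioids.lean`:

* `Hom.pullbackObj φ A`: the system `(φ_v^* S_{φ v}, φ_e^* T_{φ e})` glued along a branch `b : e → v`
  by the 2-isomorphism `φ_b` of Remark 2.4.2 followed by `φ_e^*` of the gluing `ψ_{φ b}` of `A`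
  (re-indexed along `edgeOf (φ b) = φ e`) — packaged as the natural isomorphism `Hom.gluingIso`
  (the gluings `ψ_b` of `B(ℋ)` themselves form the natural isomorphism `ψNatIso : ρ_w ⋙ b^* ≅ ρ_e`);
* `Hom.pullbackMap`, `Hom.pullbackFunctor φ : ℋ.BObj ⥤ 𝒢.BObj`, and the (definitional)
  compatibilities with the restriction functors `ρ_v`, `ρ_e`:
  `pullbackFunctor ⋙ ρ_v = ρ_{φ v} ⋙ φ_v^*`.

That this functor is exact (so that it IS a morphism of anabelioids `B(𝒢) → B(ℋ)`) is the content of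
the named fact `remark_2_11_1_toB` (`GeneralizedMorphisms.lean`) and is not proved here (it needs
finite (co)limits in `B(−)` to be componentwise, cf. the named fact `bOf_galoisCategory`).
Deliberately NOT here: the generalized-morphism version (same construction along `Cat(Φ)`).
-/

namespace Literature.AnabelianGeometry.SemiGraphs

open CategoryTheory CategoryTheory.Limits
open Literature.AnabelianGeometry.Anabelioids

universe v₁ u₁ u

namespace SemiGraphOfAnabelioids

namespace Hom

variable {𝒢 ℋ : SemiGraphOfAnabelioids.{v₁, u₁, u}} (φ : Hom 𝒢 ℋ)

/-- The gluing isomorphisms `ψ_b : b^* S_w ⥲ T_e` of the objects of `B(ℋ)` along a branch `b` of `e`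
abutting to `w`, as a natural isomorphism `ρ_w ⋙ b^* ≅ ρ_e` of functors on `B(ℋ)` (naturality is the
compatibility `BObj.Hom.comm` of morphisms with the gluing). [cite: MochizukiSemiAnbd2006, Def. 2.1 p.23] -/
def _root_.Literature.AnabelianGeometry.SemiGraphs.SemiGraphOfAnabelioids.ψNatIso
    (ℋ : SemiGraphOfAnabelioids.{v₁, u₁, u}) (b : ℋ.graph.Branch) (w : ℋ.graph.Vertex)
    (h : ℋ.graph.abuts b = some w) :
    ℋ.ρ w ⋙ (ℋ.pull b w h).pullback ≅ ℋ.ρE (ℋ.graph.edgeOf b) :=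
  NatIso.ofComponents (fun A => A.ψ b w h) (fun g => g.comm b w h)

/-- Bookkeeping: the edge component `φ_e` is indexed by a target edge `f` with a proof `φ e = f`
(`Hom.φE e f p`); the functors `ρ_f ⋙ φ_e^*` for two such indexings of the same edge are canonically
isomorphic (equal after substitution). [cite: MochizukiSemiAnbd2006, Rem. 2.4.2 p.26] -/
def reindexIso (e : 𝒢.graph.Edge) (f f' : ℋ.graph.Edge) (p : φ.base.edgeMap e = f)
    (p' : φ.base.edgeMap e = f') :
    ℋ.ρE f ⋙ (φ.φE e f p).pullback ≅ ℋ.ρE f' ⋙ (φ.φE e f' p').pullback :=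
  eqToIso (by subst p; subst p'; rfl)

/-- The gluing of the pull-back along a branch `b` of `e` abutting to `v`, as a natural isomorphism of
functors `B(ℋ) ⥤ 𝒢_e`: `ρ_{φ v} ⋙ φ_v^* ⋙ b^* ≅ ρ_{φ v} ⋙ (φ b)^* ⋙ φ_e^* ≅ ρ_{edgeOf (φ b)} ⋙ φ_e^*
≅ ρ_{φ e} ⋙ φ_e^*` — the 2-isomorphism `φ_b` of Remark 2.4.2, then `φ_e^*` of the gluing of `B(ℋ)`
along `φ b`, then re-indexing along `edgeOf (φ b) = φ e`. [cite: MochizukiSemiAnbd2006, Rem. 2.11.1 p.32] -/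
noncomputable def gluingIso (b : 𝒢.graph.Branch) (v : 𝒢.graph.Vertex) (h : 𝒢.graph.abuts b = some v) :
    ℋ.ρ (φ.base.vertexMap v) ⋙ ((φ.φV v).pullback ⋙ (𝒢.pull b v h).pullback) ≅
      ℋ.ρE (φ.base.edgeMap (𝒢.graph.edgeOf b)) ⋙
        (φ.φE (𝒢.graph.edgeOf b) (φ.base.edgeMap (𝒢.graph.edgeOf b)) rfl).pullback :=
  Functor.isoWhiskerLeft (ℋ.ρ (φ.base.vertexMap v)) (φ.φB b v h) ≪≫
    Functor.isoWhiskerRight (ℋ.ψNatIso (φ.base.branchMap b) (φ.base.vertexMap v)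
        (φ.base.abuts_branchMap b v h))
      (φ.φE (𝒢.graph.edgeOf b) (ℋ.graph.edgeOf (φ.base.branchMap b))
        (φ.base.edgeOf_branchMap b).symm).pullback ≪≫
    φ.reindexIso (𝒢.graph.edgeOf b) _ _ (φ.base.edgeOf_branchMap b).symm rfl

/-- The pull-back `φ^* A ∈ B(𝒢)` of an object `A = (S_w, T_f, ψ) ∈ B(ℋ)` along `φ : 𝒢 → ℋ`
([SemiAnbd] Rmk. 2.11.1; p. 23): vertex objects `φ_v^* S_{φ v}`, edge objects `φ_e^* T_{φ e}`, glued
along a branch `b` of `e` abutting to `v` by `gluingIso` (`φ_b`, then `φ_e^*` of `ψ_{φ b}`).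
[cite: MochizukiSemiAnbd2006, Rem. 2.11.1 p.32] -/
noncomputable def pullbackObj (A : ℋ.BObj) : 𝒢.BObj where
  S v := (φ.φV v).pullback.obj (A.S (φ.base.vertexMap v))
  T e := (φ.φE e (φ.base.edgeMap e) rfl).pullback.obj (A.T (φ.base.edgeMap e))
  ψ b v h := (φ.gluingIso b v h).app A

/-- The pull-back along `φ` of a morphism of `B(ℋ)` (componentwise); compatibility with the gluing is
the naturality of `gluingIso`. [cite: MochizukiSemiAnbd2006, Rem. 2.11.1 p.32] -/
noncomputable def pullbackMap {A B : ℋ.BObj} (g : A ⟶ B) : φ.pullbackObj A ⟶ φ.pullbackObj B where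
  fS v := (φ.φV v).pullback.map (g.fS (φ.base.vertexMap v))
  fT e := (φ.φE e (φ.base.edgeMap e) rfl).pullback.map (g.fT (φ.base.edgeMap e))
  comm b v h := (φ.gluingIso b v h).hom.naturality g

/-- **[SemiAnbd] Remark 2.11.1** (second assertion, for morphisms): the pull-back functor
`φ^* : B(ℋ) ⥤ B(𝒢)` of a morphism of semi-graphs of anabelioids `φ : 𝒢 → ℋ` — the functor underlying
the morphism of anabelioids `B(𝒢) → B(ℋ)` it "determines, in a natural fashion" (its exactness is the
named fact `remark_2_11_1_toB`). [cite: MochizukiSemiAnbd2006, Rem. 2.11.1 p.32] -/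
noncomputable def pullbackFunctor : ℋ.BObj ⥤ 𝒢.BObj where
  obj A := φ.pullbackObj A
  map g := φ.pullbackMap g
  map_id A := by
    ext <;> simp [pullbackMap, pullbackObj]
  map_comp f g := by
    ext <;> simp [pullbackMap, pullbackObj]

/-- Vertex objects of the pull-back: `(φ^* A)_v = φ_v^* A_{φ v}`.
[cite: MochizukiSemiAnbd2006, Rem. 2.11.1 p.32] -/
@[simp] theorem pullbackFunctor_obj_S (A : ℋ.BObj) (v : 𝒢.graph.Vertex) :
    (φ.pullbackFunctor.obj A).S v = (φ.φV v).pullback.obj (A.S (φ.base.vertexMap v)) := rfl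

/-- Edge objects of the pull-back: `(φ^* A)_e = φ_e^* A_{φ e}`.
[cite: MochizukiSemiAnbd2006, Rem. 2.11.1 p.32] -/
@[simp] theorem pullbackFunctor_obj_T (A : ℋ.BObj) (e : 𝒢.graph.Edge) :
    (φ.pullbackFunctor.obj A).T e =
      (φ.φE e (φ.base.edgeMap e) rfl).pullback.obj (A.T (φ.base.edgeMap e)) := rfl

/-- Vertex components of pulled-back morphisms. [cite: MochizukiSemiAnbd2006, Rem. 2.11.1 p.32] -/
@[simp] theorem pullbackFunctor_map_fS {A B : ℋ.BObj} (g : A ⟶ B) (v : 𝒢.graph.Vertex) :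
    (φ.pullbackFunctor.map g).fS v = (φ.φV v).pullback.map (g.fS (φ.base.vertexMap v)) := rfl

/-- Edge components of pulled-back morphisms. [cite: MochizukiSemiAnbd2006, Rem. 2.11.1 p.32] -/
@[simp] theorem pullbackFunctor_map_fT {A B : ℋ.BObj} (g : A ⟶ B) (e : 𝒢.graph.Edge) :
    (φ.pullbackFunctor.map g).fT e =
      (φ.φE e (φ.base.edgeMap e) rfl).pullback.map (g.fT (φ.base.edgeMap e)) := rfl

/-- Compatibility with restriction to a vertex: `φ^* ⋙ ρ_v = ρ_{φ v} ⋙ φ_v^*` — the square of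
pull-back functors underlying "`𝒢_v → B(𝒢) → B(ℋ)` = `𝒢_v → ℋ_{φ v} → B(ℋ)`" (p. 23).
[cite: MochizukiSemiAnbd2006, Def. 2.1 p.23] -/
theorem pullbackFunctor_comp_ρ (v : 𝒢.graph.Vertex) :
    φ.pullbackFunctor ⋙ 𝒢.ρ v = ℋ.ρ (φ.base.vertexMap v) ⋙ (φ.φV v).pullback := rfl

/-- Compatibility with restriction to an edge: `φ^* ⋙ ρ_e = ρ_{φ e} ⋙ φ_e^*`.
[cite: MochizukiSemiAnbd2006, Def. 2.1 p.23] -/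
theorem pullbackFunctor_comp_ρE (e : 𝒢.graph.Edge) :
    φ.pullbackFunctor ⋙ 𝒢.ρE e = ℋ.ρE (φ.base.edgeMap e) ⋙ (φ.φE e (φ.base.edgeMap e) rfl).pullback :=
  rfl

end Hom

end SemiGraphOfAnabelioids

end Literature.AnabelianGeometry.SemiGraphs
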